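import Summits.BirchSwinnertonDyer.BirchSwinnertonDyer.Theorems.ThetaPartnerAtTwoSignedControlAtTwoLocalHTwoPrimaryTorsion
import Summits.BirchSwinnertonDyer.Rank1Residual.X11b.LocalTrivialityBridge
import Literature.NumberTheory.GaloisRepresentations.HochschildSerreEdgeCoinvariants
import Literature.NumberTheory.GaloisRepresentations.PadicIntCdOne
import Literature.NumberTheory.GaloisCohomology.ShaTwoKernelResZpExtension
import Literature.NumberTheory.EllipticCurves.SubgroupSelmer
import HarnessLib

/-!
# DIV «`(γ − 1) · H¹(K_∞, E[p^∞]) = H¹(K_∞, E[p^∞])`» ⟸ `Ш²(K, E[p^∞]) = 0` — for EVERY number field `K`,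
# EVERY prime `p`, EVERY `ℤ_p`-extension `K_∞/K` and EVERY elliptic curve `E/K`
# (crux K4 `SignedControlAtTwo`, stmt-BirchSwinnertonDyer-20309, PROP412-BYPASS assembled)

Route `ThetaPartnerAtTwo` (TP2; crux shared with `ResidualThetaTransportAtTwo`), crux K4, memo
`Cruxes/SignedControlAtTwo/PROP412-BYPASS.md` (seat `bsd-inputs-k4-p1`). THEOREMS ONLY (no definition, no
named fact, no `sorry`).

Greenberg's Proposition 4.12 (LNM 1716, p. 119: «`H¹(F_Σ/F_∞, E[p^∞])` has no proper `Λ`-submodule of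
finite index», proved through `H²(F_Σ/F, Hom(Λ, E[p^∞]))`) entered K4 only as the divisibility DIV of the
ambient module under `γ − 1` (door `signedEndCoinvariants_subsingleton_of_ambient … hdiv hlift`).  This file
assembles the seat's generic level-`K` road to DIV (no `Λ`-adic `H²`):

  `Ш²(K, E[p^∞]) = 0`
  ⟹ (local `H²(K_v, E[p^∞]) = 0` at every finite `v`, `…LocalHTwoPrimaryTorsion`, Milne I §3; archimedean
     decomposition groups lie in `Gal(K̄/K_∞)`, `ShaTwoKernelResZpExtension`)
  `res : H²(K, E[p^∞]) → H²(K_∞, E[p^∞])` injective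
  ⟹ (Hochschild–Serre edge `H¹(Γ, H¹(K_∞, ·)) ↪ Ker res²`, `cd_p(Γ) = 1`, and `H¹(ℤ_p, D) = 0 ⇒ D = (γ−1)D`,
     `HochschildSerreEdgeCoinvariants` + `PadicQuotientHOneCoinvariants`)
  **`∀ s ∈ H¹(K_∞, E[p^∞]) ∃ t, γ·t − t = s`**.

Main statement `forall_exists_conjH1_sub_eq_of_shaTwo_eq_bot`: for a number field `K` (`K : Type`), an elliptic
`W/K`, a prime `p`, a `ℤ_p`-extension `κ` with topological generator `γ`, if
`shaTwo (X11b.LocBridge.primaryGaloisModule W p) = ⊥` then every class of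
`W.subgroupH1 p κ.kerSubgroup = H¹(Gal(K̄/K_∞), E[p^∞])` is `conj_γ t − t`.  NO hypothesis on the reduction
of `E`, on `E(K)[p]`, on `Sel`, or on `p`: everything specific went into the single input `Ш² = 0` (for which
see w2 g5's `…ShaTwoPrimaryFinite` ⟸ `poitouTate_sha_tateDual K`, and the line's stub
`stub_shaTwoPrimaryVanishing`).  Compare the row-specific twin `SignedEC.ResTwo.resTwo_injective_of_shaTwo`
(`…ResTwoOfShaTwo`, `K = ℚ`, `p = 2`, good supersingular) + `SignedEC.HOneCoinv` (`…HOneCoinvObstruction`).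
Also recorded: `resSubgroup_kerSubgroup_two_injective_of_shaTwo_eq_bot` (the intermediate `hres`, any `K`, `p`, `E`).
BSD is not proved by any of this; closes no item by itself.

References: [GreenbergLNM1716] §4 Appendix Prop. 4.10, pp. 113–119; [MilneADT2006] I Cor. 2.3, §3, Thm. 4.10;
[Harari2020] Prop. A.66, §17.3; [SerreLocalFields1979] XIII §1; [Washington1997] §13.1.
-/

set_option autoImplicit false
-- the Theorems namespace of this sub repeats the summit name by design (D-0017 nested layout)
set_option linter.dupNamespace false

noncomputable section

open scoped Classical NumberField

namespace Summit.BirchSwinnertonDyer.BirchSwinnertonDyer.Theorems.SignedEC.PrimaryTorsionH2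

open CategoryTheory ContinuousCohomology Function NumberField IsDedekindDomain Field WeierstrassCurve
open _root_.TopRep
open Literature.NumberTheory.EllipticCurves Literature.NumberTheory.GaloisRepresentations
  Literature.NumberTheory.GaloisCohomology
open Summit.BirchSwinnertonDyer.Rank1Residual.X11b

variable {K : Type} [Field K] [NumberField K] (W : WeierstrassCurve K) [W.IsElliptic]
  (p : ℕ) [hp : Fact p.Prime] (κ : ZpExtension K p)

/-- **`Ш²(K, E[p^∞]) = 0 ⟹ res : H²(Γ_K, E[p^∞]) → H²(Gal(K̄/K_∞), E[p^∞])` is injective**, for every number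
field `K`, prime `p`, `ℤ_p`-extension `κ` and elliptic `W` (the local `H²(K_v, E[p^∞])` vanish at all finite `v`;
the infinite places lie below `K_∞`). [cite: MilneADT2006, I Cor. 2.3 and §3] [cite: Washington1997, §13.1]
[cite: GreenbergLNM1716, §4 Appendix p. 113] -/
theorem resSubgroup_kerSubgroup_two_injective_of_shaTwo_eq_bot
    (hsha : DiscreteGaloisModule.shaTwo (LocBridge.primaryGaloisModule W p) = ⊥)
    (x : galoisCohomology (LocBridge.primaryGaloisModule W p) 2)
    (hx : resSubgroup (LocBridge.primaryGaloisModule W p).toTopRep κ.kerSubgroup 2 x = 0) : x = 0 :=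
  resSubgroup_kerSubgroup_two_eq_zero_imp_eq_zero κ (LocBridge.primaryGaloisModule W p) hsha
    (fun v ↦ subsingleton_galoisCohomology_two_toLocal_primaryTorsion W p v
      (LocBridge.primaryGaloisModule W p) (fun _ _ ↦ rfl)) x hx

/-- **DIV from `Ш² = 0`, every number field / prime / `ℤ_p`-extension / elliptic curve**: if
`Ш²(K, E[p^∞]) = 0` then for every topological generator `γ` of `Gal(K_∞/K)` and every class
`s ∈ H¹(Gal(K̄/K_∞), E[p^∞])` there is `t` with `conj_γ t − t = s` — the «(γ−1)-divisibility» of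
`H¹(K_∞, E[p^∞])` (dually: the Pontryagin dual has no `T`-torsion), which is all that Greenberg's Prop. 4.12 /
Prop. 4.9 contribute to the control arguments of the line. Assembly of the seat's Literature theorems
`exists_conjMap_sub_eq_of_resSubgroup_two_injective` (HS edge + `cd_p(ℤ_p) = 1` + `H¹(ℤ_p, D) = 0 ⇒ D = (γ−1)D`)
and `resSubgroup_kerSubgroup_two_injective_of_shaTwo_eq_bot`.
[cite: GreenbergLNM1716, §4 Appendix Prop. 4.10 and pp. 116–119] [cite: Harari2020, Prop. A.66]
[cite: SerreLocalFields1979, XIII §1 Prop. 1] -/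
theorem forall_exists_conjH1_sub_eq_of_shaTwo_eq_bot {γ : absoluteGaloisGroup K} (hγ : κ.IsTopGenerator γ)
    (hsha : DiscreteGaloisModule.shaTwo (LocBridge.primaryGaloisModule W p) = ⊥)
    (s : W.subgroupH1 p κ.kerSubgroup) :
    ∃ t : W.subgroupH1 p κ.kerSubgroup, W.conjH1 p κ.kerSubgroup γ t - t = s := by
  haveI : CompactSpace (absoluteGaloisGroup K) := absoluteGaloisGroup_compactSpace K
  haveI : T2Space (absoluteGaloisGroup K) := krullTopology_t2
  haveI : IsClosed (κ.kerSubgroup : Set (absoluteGaloisGroup K)) := κ.isClosed_kerSubgroup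
  let ρ : DiscreteGaloisModule K (W.geomPrimaryTorsion p) := LocBridge.primaryGaloisModule W p
  -- `E[p^∞]` is `p`-primary
  have hprim : IsPrimaryTorsion p (W.geomPrimaryTorsion p) := fun a ↦ by
    obtain ⟨k, hk⟩ := (AddCommGroup.mem_primaryComponent).1 a.2
    exact ⟨k, Subtype.ext (by rw [AddSubgroupClass.coe_nsmul, hk]; rfl)⟩
  -- `cd_p(Γ_K / Gal(K̄/K_∞)) ≤ 1`
  have hcd : GroupCdLE (absoluteGaloisGroup K ⧸ κ.kerSubgroup) p 1 := groupCdLE_one_quotient_kerSubgroup κ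
  -- `res²` injective from `Ш² = 0`
  have hinj : ∀ x : continuousCohomology 2 ρ.toTopRep, resSubgroup ρ.toTopRep κ.kerSubgroup 2 x = 0 → x = 0 :=
    fun x hx ↦ resSubgroup_kerSubgroup_two_injective_of_shaTwo_eq_bot W p κ hsha x hx
  -- the Hochschild–Serre / `ℤ_p`-coinvariants theorem, in the tree's `conjMap` currency
  obtain ⟨t, ht⟩ := exists_conjMap_sub_eq_of_resSubgroup_two_injective κ.toContinuousMonoidHom κ.kerSubgroup ρ
    κ.surjective (fun g ↦ ZpExtension.mem_kerSubgroup) hγ hcd hprim hinj s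
  exact ⟨t, ht⟩

end Summit.BirchSwinnertonDyer.BirchSwinnertonDyer.Theorems.SignedEC.PrimaryTorsionH2

end
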